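import Mathlib
import Literature.NumberTheory.LFunctions.RiemannXi
import Literature.NumberTheory.LFunctions.SuzukiSingleOperatorKernel
import Summits.RiemannHypothesis.RiemannHypothesis.Theorems.SuzukiCleanRadiusDefs

/-!
# SuzukiSharpRadius — definitions: the SHARP linear clean radius of Suzuki's single operator (column DBR; RH-FREE; defs only)

RH-FREE typed statements of the cell rh-dbr's theory target T-LCR⋆ (rh-dbr-theory g7, 2026-08-26T07:03Z; memo TARGET-v7 §K.8,
Lean sketch `SuzukiSharpRadius.lean`, namespace `RhDbrTheory.SharpRadius`), typed here VERBATIM so that provers can discharge them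
one by one (`--supports stmt-RiemannHypothesis-19733 --as helper`, no ledger items):
saddle-point (imaginary-axis) evaluation of the inverse Fourier integral (1.9) of [Su20] (M. Suzuki, ASPM 84 (2020) =
arXiv:1907.07302): `|K_θ(x)| ≤ C · exp(b·x − 2θ · inf_u Re ξ'/ξ(½+b+iu))` for every line `Im z = b`, `b > ½`; with
`inf_u = value at u = 0` (S2, modulo classical finite zero facts) and the closed form `ξ'/ξ(1) = 1 + γ/2 − ½ log 4π` (S1),
optimising `b ↓ ½` gives: every window `t ≤ c·θ` is clean for large `θ`, for every `c < c⋆ := 2 + γ − log 4π = 0.0461914…`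
(S4), within `2·10⁻⁵` of the semiclassical onset `2Σγ⁻² = 0.0462100` (the large-θ limit of the data column's `t_HS(θ)/θ`).
* S1 `XiLogDerivAtOne` (M; PROVED in `Theorems.SuzukiSharpRadiusXiAtOne`) · S2 `XiLogDerivMinOnAxis` (M given zero facts) ·
  S3 `SaddleHeightBound` (L) · S4 `LinearCleanRadiusSharp` (the target) · S5 `SharpRadiusReduction` (M) ·
  S6 `SharpImpliesLinear` (proved here: `sharpImpliesLinear`; its hypothesis `0 < c⋆` is `sharpCleanConst_pos` of the S1 file).
Labels: every statement is RH-FREE (line 1 of each docstring); `LinearCleanRadius` itself is the tree theorem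
`SuzukiCleanRadius.linearCleanRadius_holds` (c ≈ 7·10⁻⁵); nothing here bears on the truth of RH.
-/

noncomputable section

-- D-0017: `Summit.<S>.<S>.…` is the designed namespace of a single-problem summit.
set_option linter.dupNamespace false

namespace Summit.RiemannHypothesis.RiemannHypothesis.Theorems.SuzukiSharpRadius

open Literature.NumberTheory.LFunctions
open Summit.RiemannHypothesis.RiemannHypothesis.Theorems.SuzukiCleanRadius

/-- RH-FREE (definition). `Re ξ'/ξ(σ + iu)`. -/
def xiLogDerivRe (σ u : ℝ) : ℝ :=
  (deriv riemannXi ((σ : ℂ) + (u : ℂ) * Complex.I) / riemannXi ((σ : ℂ) + (u : ℂ) * Complex.I)).re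

/-- RH-FREE (definition). The sharp clean-radius constant `c⋆ = 2 ξ'/ξ(1) = 2 + γ − log(4π) = 0.046191…`. -/
def sharpCleanConst : ℝ := 2 + Real.eulerMascheroniConstant - Real.log (4 * Real.pi)

/-- RH-FREE (classical value; from `ζ'/ζ(s) = −1/(s−1) + γ + O(s−1)` and `ψ(½) = −γ − 2 log 2`).
`ξ'/ξ(1) = 1 + γ/2 − ½ log(4π)`. -/
def XiLogDerivAtOne : Prop :=
  xiLogDerivRe 1 0 = 1 + Real.eulerMascheroniConstant / 2 - Real.log (4 * Real.pi) / 2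

/-- RH-FREE modulo the finite zero facts F0 (no zero of ξ with |Im| < 14) and F1 (γ₁ ∈ [14.13,14.14], γ₂ ∈ [21.02,21.03]):
on the lines `1 < σ ≤ 2` the minimum over `u` of `Re ξ'/ξ(σ+iu)` is attained at `u = 0`
(zero sum `Re ξ'/ξ(s) = Σ_ρ (σ−β)/|s−ρ|²`, each conjugate pair term increasing in `|u| ≤ |γ_ρ|`; `|u| ≥ 23` by Stirling). -/
def XiLogDerivMinOnAxis : Prop :=
  ∀ σ u : ℝ, 1 < σ → σ ≤ 2 → xiLogDerivRe σ 0 ≤ xiLogDerivRe σ u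

/-- RH-FREE (analytic; contour shift of [Su20] (1.9) to `Im z = b`, `|Θ_θ(u+ib)| = exp(−2θ Re ξ'/ξ(½+b+iu))`, tail by Stirling):
`|K_θ(x)| ≤ C(θ₀,b₁) · exp(b x − 2 θ m)` whenever `m ≤ inf_u Re ξ'/ξ(½+b+iu)`, uniformly in `θ ≥ θ₀ > 1`, `½ < b ≤ b₁`. -/
def SaddleHeightBound : Prop :=
  ∀ θ₀ : ℝ, 1 < θ₀ → ∀ b₁ : ℝ, 1 / 2 < b₁ → ∃ C : ℝ, ∀ θ : ℝ, θ₀ ≤ θ → ∀ b : ℝ, 1 / 2 < b → b ≤ b₁ →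
    ∀ m : ℝ, (∀ u : ℝ, m ≤ xiLogDerivRe (1 / 2 + b) u) → ∀ x : ℝ, |limKernel θ x| ≤ C * Real.exp (b * x - 2 * θ * m)

/-- **RH-FREE target `LinearCleanRadiusSharp`**: for every `c < c⋆ = 2 + γ − log 4π` there is `θ₁` with
`CleanUpTo θ (c·θ)` for all `θ ≥ θ₁` (sharp form of `LinearCleanRadius`, whose landed constant is `≈ 7·10⁻⁵`). -/
def LinearCleanRadiusSharp : Prop :=
  ∀ c : ℝ, c < sharpCleanConst → ∃ θ₁ : ℝ, ∀ θ : ℝ, θ₁ ≤ θ → CleanUpTo θ (c * θ)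

/-- RH-FREE (M-sized logic + continuity of `σ ↦ ξ'/ξ(σ)` at `σ = 1` + `noUnitEigenvalue_of_small_window`):
the three analytic inputs give the sharp radius. -/
def SharpRadiusReduction : Prop :=
  SaddleHeightBound → XiLogDerivMinOnAxis → XiLogDerivAtOne → LinearCleanRadiusSharp

/-- RH-FREE (trivial once `0 < c⋆`, i.e. `γ > log(4π) − 2 = 0.53102…`; see `sharpCleanConst_pos` in
`Theorems.SuzukiSharpRadiusXiAtOne`). -/
def SharpImpliesLinear : Prop :=
  0 < sharpCleanConst → LinearCleanRadiusSharp → LinearCleanRadius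

/-- `SharpImpliesLinear` holds (pure logic: take `c = c⋆/2`). -/
theorem sharpImpliesLinear : SharpImpliesLinear := by
  intro hpos h
  obtain ⟨θ₁, hθ⟩ := h (sharpCleanConst / 2) (by linarith)
  exact ⟨sharpCleanConst / 2, by positivity, θ₁, hθ⟩

/-! ## Appended 2026-08-26 (rh-dbr-eng-5 g2): the fixed-line / one-line forms used by the proofs
(`Theorems.SuzukiSharpRadius`, `Theorems.SuzukiSharpRadiusEight`) -/

/-- RH-FREE (S3′, the FIXED-LINE form of `SaddleHeightBound`, which is what the reduction to the sharp radius uses;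
PROVED in `Theorems.SuzukiSharpRadius`): for every `θ₀ > 1` and every single line `Im z = b`, `b > ½`, there is
`C = C(θ₀, b)` with `|K_θ(x)| ≤ C · exp(b x − 2 θ m)` for all `θ ≥ θ₀`, all `m ≤ inf_u Re ξ'/ξ(½+b+iu)` and all real `x`
(`C = (2π)⁻¹ e^{2θ₀ Re ξ'/ξ(½+b)} ∫ |Θ_{θ₀}(u+ib)| du`).  The typed `SaddleHeightBound` asks in addition for uniformity in
`½ < b ≤ b₁`, which needs `ζ'/ζ(σ+it) ≪ log t` uniformly as `σ ↓ 1` and is not needed: for each `c < c⋆` one line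
`b = b(c)` is fixed first. -/
def SaddleHeightBoundAt : Prop :=
  ∀ θ₀ : ℝ, 1 < θ₀ → ∀ b : ℝ, 1 / 2 < b → ∃ C : ℝ, ∀ θ : ℝ, θ₀ ≤ θ →
    ∀ m : ℝ, (∀ u : ℝ, m ≤ xiLogDerivRe (1 / 2 + b) u) → ∀ x : ℝ, |limKernel θ x| ≤ C * Real.exp (b * x - 2 * θ * m)

/-- RH-FREE (S2 on ONE line `Re s = σ`): the minimum over `u` of `Re ξ'/ξ(σ+iu)` is attained at `u = 0`.
`XiLogDerivMinOnAxis` is `∀ σ ∈ (1,2], XiLogDerivMinOnAxisAt σ`.  For `σ = 8` it is a theorem of the explicit formula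
`ξ'/ξ(s) = 1/s + 1/(s−1) − ½log π + ½ψ(s/2) − Σ Λ(n)n^{-s}` ALONE (Gauss' series for `Re ψ(s/2) − ψ(σ/2)` absorbs the
`u`-variation of `Re(1/s + 1/(s−1))` once `Σ_{k≥1} (σ−1)³/(σ+2k)³ ≥ 1`, and `Re Σ Λ(n)n^{-s} ≤ Σ Λ(n)n^{-σ}`): no zero
information is needed (`Theorems.SuzukiSharpRadiusEight`). -/
def XiLogDerivMinOnAxisAt (σ : ℝ) : Prop :=
  ∀ u : ℝ, xiLogDerivRe σ 0 ≤ xiLogDerivRe σ u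

/-- RH-FREE predicate «every `c < c₀` is a linear clean radius»: for every `c < c₀` there is `θ₁` with `CleanUpTo θ (c·θ)`
for all `θ ≥ θ₁`.  `LinearCleanRadiusSharp` is literally `LinearCleanRadiusBelow sharpCleanConst`; the one-line minimum at
`σ` gives `LinearCleanRadiusBelow (xiLogDerivRe σ 0 / (σ − ½))` (`Theorems.SuzukiSharpRadius`). -/
def LinearCleanRadiusBelow (c₀ : ℝ) : Prop :=
  ∀ c : ℝ, c < c₀ → ∃ θ₁ : ℝ, ∀ θ : ℝ, θ₁ ≤ θ → CleanUpTo θ (c * θ)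

end Summit.RiemannHypothesis.RiemannHypothesis.Theorems.SuzukiSharpRadius

end
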